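import Literature.Analysis.FluidPDE.ClassicalSolution
import Literature.Analysis.FunctionSpaces.TorusPeriodization
import HarnessLib

/-!
# Classical solutions on `ℝ^d` versus the flat torus: the bridges hold

Proof layer (all results proved; no definitions, no named facts) for the three torus-bridge
named facts of `Literature.Analysis.FluidPDE.ClassicalSolution` (§ "Bridge to the flat torus"):

* `IsClassicalNSSolutionOn.of_torus_holds` — a classical solution of the forced incompressible
  Navier–Stokes/Euler system on `𝕋^d × S` (`Literature.Analysis.FunctionSpaces.Torus.IsClassicalNSSolutionOn`)
  lifts to a (`ℤ^d`-periodic) classical solution on `ℝ^d × S`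
  (`Literature.Analysis.FluidPDE.IsClassicalNSSolutionOn`) with data `lift ∘ f`, `lift ∘ u`,
  `lift ∘ p`;
* `IsClassicalNSSolutionOn.to_torus_holds` — conversely, a classical solution on `ℝ^d × S` all of
  whose data are periodic lifts descends to the torus;
* `isClassicalNSSolutionOn_lift_iff_holds` — the two notions agree on periodic lifts (the
  interim proof `⟨to_torus, of_torus⟩`, with both bridges now theorems).

This is the standing identification behind the periodic Clay problem: Lemarié-Rieusset,
*The Navier–Stokes Problem in the 21st Century* (2016), §1.3, eqs. (1.10)–(1.13) and statements
(B), (D) — "the domain is assumed to be the torus `ℝ³/ℤ³`, i.e., one deals with periodical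
functions" — reproducing Fefferman's (8), (10)–(11); functions on `𝕋ⁿ` *are* `1`-periodic
functions on `ℝⁿ` (Grafakos, *Classical Fourier Analysis*, §3.1.1).

## Proof

Everything is pointwise bookkeeping along the covering map `proj : ℝ^d → 𝕋^d`:
space–time smoothness and the one-sided time derivative agree *definitionally*
(`isSmoothSpaceTimeOn_iff_torus`, `timeDerivWithin_lift`); the convective derivative and the
gradient commute with the lift by `Torus.fderiv_lift` (`convect_lift`, `Torus.gradient_lift`),
the Laplacian by translation invariance of `iteratedFDeriv` (`Torus.laplacian_lift`, from
`TorusPeriodization`); hence the momentum equation for the lifted fields at `y` is the torus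
momentum equation at `proj y`, and `proj` is surjective (`momentum_lift_iff`). Incompressibility
transfers for `C¹` slices by `Torus.isDivFree_iff_trace_fderiv_lift` (`isDivFree_lift_iff`), the
slices being smooth by `IsSmoothSpaceTimeOn.isSmooth_slice`.

## References

* P. G. Lemarié-Rieusset, *The Navier–Stokes Problem in the 21st Century*, CRC Press (2016),
  §1.3, eqs. (1.10)–(1.13), problems (B), (D). [LemarieRieusset2016]
* C. L. Fefferman, *Existence and smoothness of the Navier–Stokes equation*, Clay Millennium
  problem description (2000/2006), eqs. (8), (10)–(11).
* L. Grafakos, *Classical Fourier Analysis*, 3rd ed. (2014), §3.1.1.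
-/

noncomputable section

open Set Function
open scoped ContDiff Laplacian InnerProductSpace RealInnerProductSpace

namespace Literature.Analysis.FluidPDE

variable {d : Type*} [Fintype d] [DecidableEq d]

omit [DecidableEq d] in
/-- The convective derivative commutes with the periodic lift, pointwise:
`((v ∘ proj)·∇)(w ∘ proj)(y) = ((v·∇)w)(proj y)` (`Torus.fderiv_lift`; the `funext` form is
`Literature.Analysis.FluidPDE.lift_convect` of `EulerReynoldsPressure`, not imported here to keep
this basic bridge free of the Euler–Reynolds layer). [folklore] -/
theorem convect_lift {G : Type*} [NormedAddCommGroup G] [InnerProductSpace ℝ G]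
    (v : UnitAddTorus d → EuclideanSpace ℝ d) (w : UnitAddTorus d → G) (y : EuclideanSpace ℝ d) :
    convect (FunctionSpaces.Torus.lift v) (FunctionSpaces.Torus.lift w) y =
      FunctionSpaces.Torus.convect v w (FunctionSpaces.Torus.proj y) := by
  rw [convect_apply, FunctionSpaces.Torus.convect, FunctionSpaces.Torus.fderiv_lift,
    FunctionSpaces.Torus.lift_apply]

/-- For `C¹` fields, the periodic lift is divergence free on `ℝ^d` (`VectorCalculus.IsDivFree`:
vanishing trace of the Fréchet derivative) iff the field is divergence free on `𝕋^d`
(`Torus.isDivFree_iff_trace_fderiv_lift`, read backwards). [folklore] -/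
theorem isDivFree_lift_iff {v : UnitAddTorus d → EuclideanSpace ℝ d}
    (hv : FunctionSpaces.Torus.IsContDiff 1 v) :
    VectorCalculus.IsDivFree (FunctionSpaces.Torus.lift v) ↔ FunctionSpaces.Torus.IsDivFree v :=
  (FunctionSpaces.Torus.isDivFree_iff_trace_fderiv_lift hv).symm

omit [DecidableEq d] in
/-- The momentum equation for the lifted (periodic) fields at time `t`, pointwise on `ℝ^d`, is
equivalent to the torus momentum equation at time `t`: all operators commute with the lift
(`timeDerivWithin_lift`, `convect_lift`, `Torus.laplacian_lift`, `Torus.gradient_lift`) and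
`proj` is surjective (Lemarié-Rieusset 2016, §1.3: (1.1) for periodic fields, (1.13)). [folklore] -/
theorem momentum_lift_iff (S : Set ℝ) (ν : ℝ) (f u : ℝ → UnitAddTorus d → EuclideanSpace ℝ d)
    (p : ℝ → UnitAddTorus d → ℝ) (t : ℝ) :
    (∀ y : EuclideanSpace ℝ d,
        timeDerivWithin S (fun s => FunctionSpaces.Torus.lift (u s)) t y +
            convect (FunctionSpaces.Torus.lift (u t)) (FunctionSpaces.Torus.lift (u t)) y =
          ν • (Δ (FunctionSpaces.Torus.lift (u t))) y -
            gradient (FunctionSpaces.Torus.lift (p t)) y + FunctionSpaces.Torus.lift (f t) y) ↔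
      ∀ x : UnitAddTorus d,
        FunctionSpaces.Torus.timeDerivWithin S u t x + FunctionSpaces.Torus.convect (u t) (u t) x =
          ν • FunctionSpaces.Torus.laplacian (u t) x - FunctionSpaces.Torus.gradient (p t) x +
            f t x := by
  simp only [timeDerivWithin_lift, convect_lift, FunctionSpaces.Torus.laplacian_lift,
    FunctionSpaces.Torus.gradient_lift, FunctionSpaces.Torus.lift_apply]
  constructor
  · intro h x
    obtain ⟨y, rfl⟩ := FunctionSpaces.Torus.proj_surjective x
    exact h y
  · intro h y
    exact h (FunctionSpaces.Torus.proj y)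

/-- **Discharge of `IsClassicalNSSolutionOn.to_torus`.** A classical solution on `ℝ^d × S` whose
data are periodic lifts descends to a classical solution on `𝕋^d × S`: smoothness is
definitional (`isSmoothSpaceTimeOn_iff_torus`), the momentum equation transfers by
`momentum_lift_iff`, and incompressibility of the smooth slices by `isDivFree_lift_iff`
(Lemarié-Rieusset 2016, §1.3, eqs. (1.10)–(1.13), problems (B), (D): "the domain is assumed to
be the torus `ℝ³/ℤ³`, i.e., one deals with periodical functions").
[cite: LemarieRieusset2016, §1.3 eqs. (1.10)–(1.13)] -/
theorem IsClassicalNSSolutionOn.to_torus_holds : IsClassicalNSSolutionOn.to_torus (d := d) := by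
  intro S ν f u p h
  have hu : FunctionSpaces.Torus.IsSmoothSpaceTimeOn S u :=
    isSmoothSpaceTimeOn_iff_torus.1 h.smooth_velocity
  exact
    { smooth_velocity := hu
      smooth_pressure := isSmoothSpaceTimeOn_iff_torus.1 h.smooth_pressure
      momentum := fun t ht => (momentum_lift_iff S ν f u p t).1 (h.momentum t ht)
      divFree := fun t ht =>
        (isDivFree_lift_iff ((hu.isSmooth_slice ht).isContDiff (by simp))).1 (h.divFree t ht) }

/-- **Discharge of `IsClassicalNSSolutionOn.of_torus`.** A classical solution on the flat torus
`𝕋^d × S` lifts to a (`ℤ^d`-periodic) classical solution on `ℝ^d × S` with data `lift ∘ f`,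
`lift ∘ u`, `lift ∘ p` (the identities of `to_torus_holds`, read forwards; Lemarié-Rieusset
2016, §1.3, eqs. (1.10)–(1.13), problems (B), (D)).
[cite: LemarieRieusset2016, §1.3 eqs. (1.10)–(1.13)] -/
theorem IsClassicalNSSolutionOn.of_torus_holds : IsClassicalNSSolutionOn.of_torus (d := d) := by
  intro S ν f u p h
  exact
    { smooth_velocity := isSmoothSpaceTimeOn_iff_torus.2 h.smooth_velocity
      smooth_pressure := isSmoothSpaceTimeOn_iff_torus.2 h.smooth_pressure
      momentum := fun t ht => (momentum_lift_iff S ν f u p t).2 (h.momentum t ht)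
      divFree := fun t ht =>
        (isDivFree_lift_iff ((h.smooth_velocity.isSmooth_slice ht).isContDiff (by simp))).2
          (h.divFree t ht) }

/-- **Discharge of `isClassicalNSSolutionOn_lift_iff`.** The two notions of classical solution —
on `ℝ^d × S` for periodic lifts, and on `𝕋^d × S` — agree (`to_torus_holds`, `of_torus_holds`;
this is the interim proof `⟨to_torus, of_torus⟩` of `ClassicalSolution` with both bridges now
proved) (Lemarié-Rieusset 2016, §1.3, eqs. (1.10)–(1.13): the periodic problem posed on `ℝ³`
*is* the problem on `ℝ³/ℤ³`). [cite: LemarieRieusset2016, §1.3 eqs. (1.10)–(1.13)] -/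
theorem isClassicalNSSolutionOn_lift_iff_holds : isClassicalNSSolutionOn_lift_iff (d := d) := by
  intro S ν f u p
  exact ⟨fun h => IsClassicalNSSolutionOn.to_torus_holds h,
    fun h => IsClassicalNSSolutionOn.of_torus_holds h⟩

end Literature.Analysis.FluidPDE
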